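/-
Copyright (c) 2026. All rights reserved.
Released under Apache 2.0 license as described in the file LICENSE.
-/
import Literature.NumberTheory.Automorphic.MaximalOrderDiscFiveBrandtSetup
import Literature.NumberTheory.Automorphic.RamifiedPrimeIdeal
import Literature.NumberTheory.Automorphic.BrandtIndexReducedNorm
import HarnessLib

/-!
# The ramified prime of the maximal order `O₅` of `(−2,−5 ∣ ℚ)`: the unique two-sided prime ideal above `5` is principal,
# `𝔓 = {x ∈ O₅ : 5 ∣ nrd x} = jO₅ = O₅j` with the uniformiser `j` (`nrd j = 5`, `j² = −5`), `[O₅ : 𝔓] = 25`, `𝔓² = 5O₅`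

[tag: quaternion_algebra] [tag: maximal_order] [tag: ramification]

Topic `NumberTheory/Automorphic`; THEOREMS ONLY (no definition, no named fact, no instance; net Literature debt `0`).
Lane `lit-hodgefound`, seat p12, gen 46 — eleventh file of the series on the definite quaternion order of discriminant `5`; the
`D = 5` twin of `MaximalOrderDiscThreeRamifiedIdeal`.

Vignéras II §1 (Lemme 1.5, Cor. 1.7): at a ramified prime `p` the completed maximal order is the valuation ring of the local
division algebra, its maximal ideal `P = {h : w(h) > 0} = Ou = uO` is two-sided and principal, generated by any element of
reduced norm exactly divisible by `p`, `P² = pO`, and `O/P` is the field with `p²` elements; Voight 13.3 (13.3.4, Thm. 13.3.11).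
For `O₅ = ℤ⟨1, i, α, η⟩ ⊂ (−2,−5 ∣ ℚ)` (`α = (1 + i + j)/2`, `η = (−2 + i + k)/4`) and `p = 5` everything is explicit and GLOBAL
(class number one): the tree's `normPrimeIdeal O₅ 5` (`RamifiedPrimeIdeal.lean`: the span of `{x ∈ O₅ : 5 ∣ nrd x}`) is the
principal two-sided ideal generated by `j = 2α − 1 − i`, because in the coordinates `x = a + bi + cα + dη` one has
`5 ∣ nrd x = a² + 2b² + 2c² + d² + ac − ad + 2bc + bd` iff `a + 3c + 2d ≡ b + 3c − d ≡ 0 (mod 5)` iff `x ∈ jO₅`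
(`MaximalOrderDiscFiveNormsFiveMul.five_dvd_form_iff`, `exists_mem_eq_basisJ_mul_of_five_dvd`; left multiplication by `j` is
`(A,B,C,D) ↦ (−A−2B−4C, −A+B+2D, 2A+C−D, −4B−2C−D)`):

* §1 the uniformiser: `basisJ_eq` (`j = 2α − 1 − i`), `basisJ_mul_basisJ` (`j² = −5`), `basisJ_mul_basisJInv`,
  `basisJInv_mul_basisJ`, **`mk_mul_basisJ`** (`x·j = j·x'` with `x' = (a − d) − (b + c)i + cα − dη` for `x = a + bi + cα + dη`:
  conjugation by `j` negates `i` and `k`, so `jO₅ = O₅j`), `basisJ_mul_mk_eq_mul_basisJ`;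
* §2 **`exists_eq_basisJ_mul_iff`** (for `x ∈ O₅`: **`x ∈ jO₅ ⟺ 5 ∣ nrd x`**), `exists_eq_mul_basisJ_iff` (`x ∈ O₅j ⟺ x ∈ jO₅`);
* §3 the ideal: `mem_basisJUnit_smul_iff`, **`normPrimeIdeal_five_eq`** (**`𝔓 := normPrimeIdeal O₅ 5 = jO₅`** — VIGNÉRAS II §1
  LEMME 1.5 ∕ VOIGHT 13.3 for this order), `coe_basisJUnit_smul_eq` (`jO₅ = O₅j` as sets: `𝔓` is two-sided),
  **`relIndex_basisJUnit_smul`** (`[O₅ : 𝔓] = 25 = 5²`: `O₅/𝔓` is the field `𝔽₂₅` as far as cardinality goes),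
  `relIndex_normPrimeIdeal_five`, `mem_basisJUnit_smul_smul_iff` (`𝔓² = jjO₅ = 5O₅`: `x ∈ 𝔓² ⟺ x = 5y`, `y ∈ O₅`),
  **`units_smul_eq_basisJUnit_smul_of_reducedNorm_eq_five`** (every `u ∈ O₅` with `nrd u = 5` generates `𝔓`: `uO₅ = jO₅` — the
  `6` elements of reduced norm `5` are the `ju`, `u ∈ O₅^×`, matching `T(5) = 1`), `basisJUnit_smul_ne` (`𝔓 ≠ O₅`: `1 ∉ 𝔓`),
  `five_smul_mem_basisJUnit_smul` (`5O₅ ⊆ 𝔓`).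

## Sources

* M.-F. Vignéras, *Arithmétique des algèbres de quaternions*, LNM 800 (1980), Ch. II §1 Lemme 1.5, Cor. 1.7 (`P = Ou = uO`,
  `P² = pO` at a ramified prime). [cite: VignerasLNM800, Ch. II §1 Lemme 1.5 and Cor. 1.7]
* J. Voight, *Quaternion Algebras*, GTM 288 (2021), 13.3.4, Thm. 13.3.11 (valuation ring, unique maximal ideal `P = OjO = jO`),
  Exercise 17.10, Thm. 11.5.14. [cite: Voight2021, §13.3 Thm. 13.3.11; Exercise 17.10]

## Scope (honest)

Theorems only — no definition, no named fact, no instance. The residue field statement `O₅/𝔓 ≅ 𝔽₂₅` is recorded only as the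
index `[O₅ : 𝔓] = 25`; the local (completed) statements of Vignéras II §1 are not restated.
-/

open Quaternion
open scoped Pointwise
open Literature.NumberTheory.Automorphic.Brandt

namespace Literature.NumberTheory.Automorphic.MaxOrderDiscFive

/-! ## §1 The uniformiser `j = 2α − 1 − i` -/

section Uniformiser

/-- `j = 2α − 1 − i` (`α = (1 + i + j)/2`). [cite: Voight2021, Exercise 17.10] -/
theorem basisJ_eq : (⟨0, 0, 1, 0⟩ : ℍ[ℚ,-2,-5]) = (2 : ℚ) • ⟨1/2, 1/2, 1/2, 0⟩ - 1 - ⟨0, 1, 0, 0⟩ := by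
  ext <;> norm_num

/-- `j² = −5`. [cite: Voight2021, Exercise 17.10] -/
theorem basisJ_mul_basisJ : (⟨0, 0, 1, 0⟩ : ℍ[ℚ,-2,-5]) * ⟨0, 0, 1, 0⟩ = ⟨-5, 0, 0, 0⟩ := by
  ext <;> norm_num [QuaternionAlgebra.mk_mul_mk]

/-- `j · (−j/5) = 1` (`j² = −5`). [cite: Voight2021, Exercise 17.10] -/
theorem basisJ_mul_basisJInv : (⟨0, 0, 1, 0⟩ : ℍ[ℚ,-2,-5]) * ⟨0, 0, -1/5, 0⟩ = 1 := by
  ext <;> norm_num [QuaternionAlgebra.mk_mul_mk]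

/-- `(−j/5) · j = 1`. [cite: Voight2021, Exercise 17.10] -/
theorem basisJInv_mul_basisJ : (⟨0, 0, -1/5, 0⟩ : ℍ[ℚ,-2,-5]) * ⟨0, 0, 1, 0⟩ = 1 := by
  ext <;> norm_num [QuaternionAlgebra.mk_mul_mk]

/-- **`jO₅ = O₅j` elementwise: `(a + bi + cα + dη)·j = j·((a − d) − (b + c)i + cα − dη)`** (conjugation by `j` negates `i`
and `k` and fixes `j`; in the coordinates of `O₅` it is `(a, b, c, d) ↦ (a − d, −b − c, c, −d)`). [cite: VignerasLNM800, Ch. II §1 Lemme 1.5] -/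
theorem mk_mul_basisJ (a b c d : ℤ) :
    (⟨(a : ℚ) + (c : ℚ) / 2 - (d : ℚ) / 2, (b : ℚ) + (c : ℚ) / 2 + (d : ℚ) / 4, (c : ℚ) / 2, (d : ℚ) / 4⟩ : ℍ[ℚ,-2,-5]) * ⟨0, 0, 1, 0⟩ =
      ⟨0, 0, 1, 0⟩ * ⟨((a - d : ℤ) : ℚ) + (c : ℚ) / 2 - ((-d : ℤ) : ℚ) / 2, ((-b - c : ℤ) : ℚ) + (c : ℚ) / 2 + ((-d : ℤ) : ℚ) / 4,
        (c : ℚ) / 2, ((-d : ℤ) : ℚ) / 4⟩ := by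
  ext <;> simp [QuaternionAlgebra.mk_mul_mk] <;> ring

/-- `j·(a + bi + cα + dη) = ((a − d) − (b + c)i + cα − dη)·j` (the same conjugation, an involution). [cite: VignerasLNM800, Ch. II §1 Lemme 1.5] -/
theorem basisJ_mul_mk_eq_mul_basisJ (a b c d : ℤ) :
    (⟨0, 0, 1, 0⟩ : ℍ[ℚ,-2,-5]) * ⟨(a : ℚ) + (c : ℚ) / 2 - (d : ℚ) / 2, (b : ℚ) + (c : ℚ) / 2 + (d : ℚ) / 4, (c : ℚ) / 2, (d : ℚ) / 4⟩ =
      ⟨((a - d : ℤ) : ℚ) + (c : ℚ) / 2 - ((-d : ℤ) : ℚ) / 2, ((-b - c : ℤ) : ℚ) + (c : ℚ) / 2 + ((-d : ℤ) : ℚ) / 4,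
        (c : ℚ) / 2, ((-d : ℤ) : ℚ) / 4⟩ * ⟨0, 0, 1, 0⟩ := by
  ext <;> simp [QuaternionAlgebra.mk_mul_mk] <;> ring

end Uniformiser

/-! ## §2 `x ∈ jO₅ ⟺ 5 ∣ nrd x` -/

section Divisibility

/-- **For `x ∈ O₅`: `x ∈ jO₅` iff `5 ∣ nrd x`** (`⟸`: the two congruences mod `5` and the explicit preimage under the `5`-map,
`MaximalOrderDiscFiveNormsFiveMul.exists_mem_eq_basisJ_mul_of_five_dvd`; `⟹`: `nrd(jy) = 5·nrd y`). [cite: VignerasLNM800, Ch. II §1 Lemme 1.5] [cite: Voight2021, §13.3 Thm. 13.3.11] -/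
theorem exists_eq_basisJ_mul_iff {x : ℍ[ℚ,-2,-5]} (hx : x ∈ (Submodule.span ℤ (Set.range ![(⟨1, 0, 0, 0⟩ : ℍ[ℚ,-2,-5]), ⟨0, 1, 0, 0⟩, ⟨1/2, 1/2, 1/2, 0⟩, ⟨-1/2, 1/4, 0, 1/4⟩]))) :
    (∃ y ∈ (Submodule.span ℤ (Set.range ![(⟨1, 0, 0, 0⟩ : ℍ[ℚ,-2,-5]), ⟨0, 1, 0, 0⟩, ⟨1/2, 1/2, 1/2, 0⟩, ⟨-1/2, 1/4, 0, 1/4⟩])), x = ⟨0, 0, 1, 0⟩ * y) ↔ ∃ n : ℤ, reducedNorm ℚ ℍ[ℚ,-2,-5] x = 5 * n := by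
  haveI := isQuaternionAlgebra
  constructor
  · rintro ⟨y, hy, rfl⟩
    obtain ⟨m, hm⟩ := exists_reducedNorm_eq_natCast_of_mem hy
    refine ⟨m, ?_⟩
    rw [reducedNorm_mul_holds ℚ ℍ[ℚ,-2,-5], reducedNorm_basisJ, hm]
    push_cast
    ring
  · exact exists_mem_eq_basisJ_mul_of_five_dvd hx

/-- **`O₅j = jO₅`**: `x` is a right multiple of `j` from `O₅` iff it is a left multiple. [cite: VignerasLNM800, Ch. II §1 Lemme 1.5] -/
theorem exists_eq_mul_basisJ_iff (x : ℍ[ℚ,-2,-5]) :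
    (∃ y ∈ (Submodule.span ℤ (Set.range ![(⟨1, 0, 0, 0⟩ : ℍ[ℚ,-2,-5]), ⟨0, 1, 0, 0⟩, ⟨1/2, 1/2, 1/2, 0⟩, ⟨-1/2, 1/4, 0, 1/4⟩])), x = y * ⟨0, 0, 1, 0⟩) ↔ ∃ y ∈ (Submodule.span ℤ (Set.range ![(⟨1, 0, 0, 0⟩ : ℍ[ℚ,-2,-5]), ⟨0, 1, 0, 0⟩, ⟨1/2, 1/2, 1/2, 0⟩, ⟨-1/2, 1/4, 0, 1/4⟩])), x = ⟨0, 0, 1, 0⟩ * y := by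
  constructor
  · rintro ⟨y, hy, rfl⟩
    obtain ⟨a, b, c, d, rfl⟩ := (mem_lattice_iff y).1 hy
    exact ⟨_, mk_mem_lattice (a - d) (-b - c) c (-d), mk_mul_basisJ a b c d⟩
  · rintro ⟨y, hy, rfl⟩
    obtain ⟨a, b, c, d, rfl⟩ := (mem_lattice_iff y).1 hy
    refine ⟨_, mk_mem_lattice (a - d) (-b - c) c (-d), ?_⟩
    rw [basisJ_mul_mk_eq_mul_basisJ]

end Divisibility

/-! ## §3 The ideal `𝔓 = normPrimeIdeal O₅ 5 = jO₅` -/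

section Ideal

/-- `x ∈ jO₅ ⟺ x = j·y` for some `y ∈ O₅` (`j` as a unit of `B`; the principal ideal `Ou = uO` of Vignéras). [cite: VignerasLNM800, Ch. II §1 Lemme 1.5] -/
theorem mem_basisJUnit_smul_iff (x : ℍ[ℚ,-2,-5]) : x ∈ (⟨⟨0, 0, 1, 0⟩, ⟨0, 0, -1/5, 0⟩, basisJ_mul_basisJInv, basisJInv_mul_basisJ⟩ : (ℍ[ℚ,-2,-5])ˣ) • (Submodule.span ℤ (Set.range ![(⟨1, 0, 0, 0⟩ : ℍ[ℚ,-2,-5]), ⟨0, 1, 0, 0⟩, ⟨1/2, 1/2, 1/2, 0⟩, ⟨-1/2, 1/4, 0, 1/4⟩])) ↔ ∃ y ∈ (Submodule.span ℤ (Set.range ![(⟨1, 0, 0, 0⟩ : ℍ[ℚ,-2,-5]), ⟨0, 1, 0, 0⟩, ⟨1/2, 1/2, 1/2, 0⟩, ⟨-1/2, 1/4, 0, 1/4⟩])), x = ⟨0, 0, 1, 0⟩ * y := by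
  rw [mem_units_smul_submodule_iff, Units.smul_def, smul_eq_mul]
  constructor
  · intro h
    refine ⟨_, h, ?_⟩
    rw [← mul_assoc]
    change x = (((⟨⟨0, 0, 1, 0⟩, ⟨0, 0, -1/5, 0⟩, basisJ_mul_basisJInv, basisJInv_mul_basisJ⟩ : (ℍ[ℚ,-2,-5])ˣ) : (ℍ[ℚ,-2,-5])ˣ) : ℍ[ℚ,-2,-5]) * ((((⟨⟨0, 0, 1, 0⟩, ⟨0, 0, -1/5, 0⟩, basisJ_mul_basisJInv, basisJInv_mul_basisJ⟩ : (ℍ[ℚ,-2,-5])ˣ)⁻¹ : (ℍ[ℚ,-2,-5])ˣ)) : ℍ[ℚ,-2,-5]) * x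
    rw [Units.mul_inv, one_mul]
  · rintro ⟨y, hy, rfl⟩
    rw [← mul_assoc]
    change ((((⟨⟨0, 0, 1, 0⟩, ⟨0, 0, -1/5, 0⟩, basisJ_mul_basisJInv, basisJInv_mul_basisJ⟩ : (ℍ[ℚ,-2,-5])ˣ)⁻¹ : (ℍ[ℚ,-2,-5])ˣ)) : ℍ[ℚ,-2,-5]) * (((⟨⟨0, 0, 1, 0⟩, ⟨0, 0, -1/5, 0⟩, basisJ_mul_basisJInv, basisJInv_mul_basisJ⟩ : (ℍ[ℚ,-2,-5])ˣ) : (ℍ[ℚ,-2,-5])ˣ) : ℍ[ℚ,-2,-5]) * y ∈ (Submodule.span ℤ (Set.range ![(⟨1, 0, 0, 0⟩ : ℍ[ℚ,-2,-5]), ⟨0, 1, 0, 0⟩, ⟨1/2, 1/2, 1/2, 0⟩, ⟨-1/2, 1/4, 0, 1/4⟩]))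
    rwa [Units.inv_mul, one_mul]

/-- **VIGNÉRAS II §1 LEMME 1.5 ∕ VOIGHT 13.3 for `O₅`: the prime ideal above the ramified prime `5` is principal, `𝔓 = jO₅`** —
`normPrimeIdeal O₅ 5` (the span of `{x ∈ O₅ : 5 ∣ nrd x}`) equals `jO₅`. [cite: VignerasLNM800, Ch. II §1 Lemme 1.5] [cite: Voight2021, §13.3 Thm. 13.3.11] -/
theorem normPrimeIdeal_five_eq : normPrimeIdeal (Submodule.span ℤ (Set.range ![(⟨1, 0, 0, 0⟩ : ℍ[ℚ,-2,-5]), ⟨0, 1, 0, 0⟩, ⟨1/2, 1/2, 1/2, 0⟩, ⟨-1/2, 1/4, 0, 1/4⟩])) 5 = (⟨⟨0, 0, 1, 0⟩, ⟨0, 0, -1/5, 0⟩, basisJ_mul_basisJInv, basisJInv_mul_basisJ⟩ : (ℍ[ℚ,-2,-5])ˣ) • (Submodule.span ℤ (Set.range ![(⟨1, 0, 0, 0⟩ : ℍ[ℚ,-2,-5]), ⟨0, 1, 0, 0⟩, ⟨1/2, 1/2, 1/2, 0⟩, ⟨-1/2, 1/4, 0, 1/4⟩])) := by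
  haveI := isQuaternionAlgebra
  haveI : Fact (Nat.Prime 5) := ⟨Nat.prime_five⟩
  have hdivp : ∀ X : ScalarExtension ℚ ℚ_[5] ℍ[ℚ,-2,-5], X ≠ 0 → IsUnit X :=
    EichlerPackage.forall_isUnit_scalarExtension_padic
      ({ B := ℍ[ℚ,-2,-5]
         instIsQuaternionAlgebra := isQuaternionAlgebra
         isTotallyDefinite := isTotallyDefinite
         mem_ramifiedPlaces_iff := mem_ramifiedPlaces_iff_five_mem
         O := (Submodule.span ℤ (Set.range ![(⟨1, 0, 0, 0⟩ : ℍ[ℚ,-2,-5]), ⟨0, 1, 0, 0⟩, ⟨1/2, 1/2, 1/2, 0⟩, ⟨-1/2, 1/4, 0, 1/4⟩]))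
         isEichlerOrder := isEichlerOrder_one_lattice } : EichlerPackage 1 5) (dvd_refl 5)
  ext x
  rw [mem_normPrimeIdeal_iff hdivp isZOrder_lattice, mem_basisJUnit_smul_iff]
  constructor
  · rintro ⟨hx, hn⟩
    exact (exists_eq_basisJ_mul_iff hx).2 (by exact_mod_cast hn)
  · rintro ⟨y, hy, rfl⟩
    have hx : (⟨0, 0, 1, 0⟩ : ℍ[ℚ,-2,-5]) * y ∈ (Submodule.span ℤ (Set.range ![(⟨1, 0, 0, 0⟩ : ℍ[ℚ,-2,-5]), ⟨0, 1, 0, 0⟩, ⟨1/2, 1/2, 1/2, 0⟩, ⟨-1/2, 1/4, 0, 1/4⟩])) := mul_mem_lattice basisJ_mem_lattice hy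
    exact ⟨hx, by exact_mod_cast (exists_eq_basisJ_mul_iff hx).1 ⟨y, hy, rfl⟩⟩

/-- **`𝔓 = jO₅ = O₅j` is two-sided.** [cite: VignerasLNM800, Ch. II §1 Lemme 1.5] -/
theorem coe_basisJUnit_smul_eq : (((⟨⟨0, 0, 1, 0⟩, ⟨0, 0, -1/5, 0⟩, basisJ_mul_basisJInv, basisJInv_mul_basisJ⟩ : (ℍ[ℚ,-2,-5])ˣ) • (Submodule.span ℤ (Set.range ![(⟨1, 0, 0, 0⟩ : ℍ[ℚ,-2,-5]), ⟨0, 1, 0, 0⟩, ⟨1/2, 1/2, 1/2, 0⟩, ⟨-1/2, 1/4, 0, 1/4⟩])) : Submodule ℤ ℍ[ℚ,-2,-5]) : Set ℍ[ℚ,-2,-5]) = {x | ∃ y ∈ (Submodule.span ℤ (Set.range ![(⟨1, 0, 0, 0⟩ : ℍ[ℚ,-2,-5]), ⟨0, 1, 0, 0⟩, ⟨1/2, 1/2, 1/2, 0⟩, ⟨-1/2, 1/4, 0, 1/4⟩])), x = y * ⟨0, 0, 1, 0⟩} := by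
  ext x
  rw [SetLike.mem_coe, mem_basisJUnit_smul_iff, Set.mem_setOf_eq, exists_eq_mul_basisJ_iff]

/-- **`[O₅ : 𝔓] = [O₅ : jO₅] = nrd(j)² = 25`** (`O₅/𝔓` has `25` elements). [cite: VignerasLNM800, Ch. II §1 Cor. 1.7] [cite: Voight2021, §13.3 Thm. 13.3.11] -/
theorem relIndex_basisJUnit_smul : ((⟨⟨0, 0, 1, 0⟩, ⟨0, 0, -1/5, 0⟩, basisJ_mul_basisJInv, basisJInv_mul_basisJ⟩ : (ℍ[ℚ,-2,-5])ˣ) • (Submodule.span ℤ (Set.range ![(⟨1, 0, 0, 0⟩ : ℍ[ℚ,-2,-5]), ⟨0, 1, 0, 0⟩, ⟨1/2, 1/2, 1/2, 0⟩, ⟨-1/2, 1/4, 0, 1/4⟩]))).toAddSubgroup.relIndex ((Submodule.span ℤ (Set.range ![(⟨1, 0, 0, 0⟩ : ℍ[ℚ,-2,-5]), ⟨0, 1, 0, 0⟩, ⟨1/2, 1/2, 1/2, 0⟩, ⟨-1/2, 1/4, 0, 1/4⟩]))).toAddSubgroup = 25 := by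
  haveI := isQuaternionAlgebra
  have hj : (((⟨⟨0, 0, 1, 0⟩, ⟨0, 0, -1/5, 0⟩, basisJ_mul_basisJInv, basisJInv_mul_basisJ⟩ : (ℍ[ℚ,-2,-5])ˣ) : (ℍ[ℚ,-2,-5])ˣ) : ℍ[ℚ,-2,-5]) ∈ leftOrder (Submodule.span ℤ (Set.range ![(⟨1, 0, 0, 0⟩ : ℍ[ℚ,-2,-5]), ⟨0, 1, 0, 0⟩, ⟨1/2, 1/2, 1/2, 0⟩, ⟨-1/2, 1/4, 0, 1/4⟩])) := by
    rw [leftOrder_lattice]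
    exact basisJ_mem_lattice
  have h := Brandt.cast_relIndex_units_smul_eq_reducedNorm_sq isFullLattice_lattice hj
  have h5 : reducedNorm ℚ ℍ[ℚ,-2,-5] (((⟨⟨0, 0, 1, 0⟩, ⟨0, 0, -1/5, 0⟩, basisJ_mul_basisJInv, basisJInv_mul_basisJ⟩ : (ℍ[ℚ,-2,-5])ˣ) : (ℍ[ℚ,-2,-5])ˣ) : ℍ[ℚ,-2,-5]) = 5 := reducedNorm_basisJ
  rw [h5] at h
  have h' := h.trans (by norm_num : (5 : ℚ) ^ 2 = 25)
  exact_mod_cast h'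

/-- `[O₅ : normPrimeIdeal O₅ 5] = 25`. [cite: VignerasLNM800, Ch. II §1 Cor. 1.7] -/
theorem relIndex_normPrimeIdeal_five : (normPrimeIdeal (Submodule.span ℤ (Set.range ![(⟨1, 0, 0, 0⟩ : ℍ[ℚ,-2,-5]), ⟨0, 1, 0, 0⟩, ⟨1/2, 1/2, 1/2, 0⟩, ⟨-1/2, 1/4, 0, 1/4⟩])) 5).toAddSubgroup.relIndex ((Submodule.span ℤ (Set.range ![(⟨1, 0, 0, 0⟩ : ℍ[ℚ,-2,-5]), ⟨0, 1, 0, 0⟩, ⟨1/2, 1/2, 1/2, 0⟩, ⟨-1/2, 1/4, 0, 1/4⟩]))).toAddSubgroup = 25 := by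
  rw [normPrimeIdeal_five_eq, relIndex_basisJUnit_smul]

/-- **`𝔓² = j²O₅ = 5O₅`**: `x ∈ j(jO₅)` iff `x = 5y` with `y ∈ O₅`. [cite: VignerasLNM800, Ch. II §1 Cor. 1.7] -/
theorem mem_basisJUnit_smul_smul_iff (x : ℍ[ℚ,-2,-5]) : x ∈ (⟨⟨0, 0, 1, 0⟩, ⟨0, 0, -1/5, 0⟩, basisJ_mul_basisJInv, basisJInv_mul_basisJ⟩ : (ℍ[ℚ,-2,-5])ˣ) • ((⟨⟨0, 0, 1, 0⟩, ⟨0, 0, -1/5, 0⟩, basisJ_mul_basisJInv, basisJInv_mul_basisJ⟩ : (ℍ[ℚ,-2,-5])ˣ) • (Submodule.span ℤ (Set.range ![(⟨1, 0, 0, 0⟩ : ℍ[ℚ,-2,-5]), ⟨0, 1, 0, 0⟩, ⟨1/2, 1/2, 1/2, 0⟩, ⟨-1/2, 1/4, 0, 1/4⟩]))) ↔ ∃ y ∈ (Submodule.span ℤ (Set.range ![(⟨1, 0, 0, 0⟩ : ℍ[ℚ,-2,-5]), ⟨0, 1, 0, 0⟩, ⟨1/2, 1/2, 1/2, 0⟩,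 ⟨-1/2, 1/4, 0, 1/4⟩])), x = (5 : ℚ) • y := by
  rw [smul_smul]
  have hjj : ((((⟨⟨0, 0, 1, 0⟩, ⟨0, 0, -1/5, 0⟩, basisJ_mul_basisJInv, basisJInv_mul_basisJ⟩ : (ℍ[ℚ,-2,-5])ˣ) * (⟨⟨0, 0, 1, 0⟩, ⟨0, 0, -1/5, 0⟩, basisJ_mul_basisJInv, basisJInv_mul_basisJ⟩ : (ℍ[ℚ,-2,-5])ˣ) : (ℍ[ℚ,-2,-5])ˣ)) : ℍ[ℚ,-2,-5]) = ⟨-5, 0, 0, 0⟩ := by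
    rw [Units.val_mul]
    exact basisJ_mul_basisJ
  have key : ∀ y : ℍ[ℚ,-2,-5], ((⟨⟨0, 0, 1, 0⟩, ⟨0, 0, -1/5, 0⟩, basisJ_mul_basisJInv, basisJInv_mul_basisJ⟩ : (ℍ[ℚ,-2,-5])ˣ) * (⟨⟨0, 0, 1, 0⟩, ⟨0, 0, -1/5, 0⟩, basisJ_mul_basisJInv, basisJInv_mul_basisJ⟩ : (ℍ[ℚ,-2,-5])ˣ)) • y = (5 : ℚ) • (-y) := fun y => by
    rw [Units.smul_def, hjj, smul_eq_mul]
    ext <;> simp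
  constructor
  · intro h
    rw [mem_units_smul_submodule_iff] at h
    refine ⟨-((((⟨⟨0, 0, 1, 0⟩, ⟨0, 0, -1/5, 0⟩, basisJ_mul_basisJInv, basisJInv_mul_basisJ⟩ : (ℍ[ℚ,-2,-5])ˣ) * (⟨⟨0, 0, 1, 0⟩, ⟨0, 0, -1/5, 0⟩, basisJ_mul_basisJInv, basisJInv_mul_basisJ⟩ : (ℍ[ℚ,-2,-5])ˣ))⁻¹ : (ℍ[ℚ,-2,-5])ˣ) • x), ((Submodule.span ℤ (Set.range ![(⟨1, 0, 0, 0⟩ : ℍ[ℚ,-2,-5]), ⟨0, 1, 0, 0⟩, ⟨1/2, 1/2, 1/2, 0⟩, ⟨-1/2, 1/4, 0, 1/4⟩]))).neg_mem h, ?_⟩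
    rw [← key, smul_inv_smul]
  · rintro ⟨y, hy, rfl⟩
    have e : (5 : ℚ) • y = ((⟨⟨0, 0, 1, 0⟩, ⟨0, 0, -1/5, 0⟩, basisJ_mul_basisJInv, basisJInv_mul_basisJ⟩ : (ℍ[ℚ,-2,-5])ˣ) * (⟨⟨0, 0, 1, 0⟩, ⟨0, 0, -1/5, 0⟩, basisJ_mul_basisJInv, basisJInv_mul_basisJ⟩ : (ℍ[ℚ,-2,-5])ˣ)) • (-y) := by rw [key, neg_neg]
    rw [e]
    exact Submodule.smul_mem_pointwise_smul _ _ _ (((Submodule.span ℤ (Set.range ![(⟨1, 0, 0, 0⟩ : ℍ[ℚ,-2,-5]), ⟨0, 1, 0, 0⟩, ⟨1/2, 1/2, 1/2, 0⟩, ⟨-1/2, 1/4, 0, 1/4⟩]))).neg_mem hy)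

/-- `𝔓²  = 5O₅` on the nose: `normPrimeIdeal O₅ 5` squared (as `j·𝔓`) is the set of `5y`, `y ∈ O₅`. [cite: VignerasLNM800, Ch. II §1 Cor. 1.7] -/
theorem mem_basisJUnit_smul_normPrimeIdeal_iff (x : ℍ[ℚ,-2,-5]) : x ∈ (⟨⟨0, 0, 1, 0⟩, ⟨0, 0, -1/5, 0⟩, basisJ_mul_basisJInv, basisJInv_mul_basisJ⟩ : (ℍ[ℚ,-2,-5])ˣ) • normPrimeIdeal (Submodule.span ℤ (Set.range ![(⟨1, 0, 0, 0⟩ : ℍ[ℚ,-2,-5]), ⟨0, 1, 0, 0⟩, ⟨1/2, 1/2, 1/2, 0⟩, ⟨-1/2, 1/4, 0, 1/4⟩])) 5 ↔ ∃ y ∈ (Submodule.span ℤ (Set.range ![(⟨1, 0, 0, 0⟩ : ℍ[ℚ,-2,-5]), ⟨0, 1, 0, 0⟩, ⟨1/2, 1/2, 1/2, 0⟩, ⟨-1/2, 1/4, 0, 1/4⟩])), x = (5 : ℚ) • y := by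
  rw [normPrimeIdeal_five_eq, mem_basisJUnit_smul_smul_iff]

/-- **Every `u ∈ O₅` of reduced norm `5` generates `𝔓`: `uO₅ = jO₅`** (`u = jε` with `ε ∈ O₅^×`; the `6` elements of reduced
norm `5` are the `jε` — one integral ideal of norm `5`, `T(5) = 1`). [cite: VignerasLNM800, Ch. II §1 Lemme 1.5] -/
theorem units_smul_eq_basisJUnit_smul_of_reducedNorm_eq_five (u : (ℍ[ℚ,-2,-5])ˣ) (hu : (u : ℍ[ℚ,-2,-5]) ∈ (Submodule.span ℤ (Set.range ![(⟨1, 0, 0, 0⟩ : ℍ[ℚ,-2,-5]), ⟨0, 1, 0, 0⟩, ⟨1/2, 1/2, 1/2, 0⟩, ⟨-1/2, 1/4, 0, 1/4⟩])))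
    (h5 : reducedNorm ℚ ℍ[ℚ,-2,-5] (u : ℍ[ℚ,-2,-5]) = 5) : u • (Submodule.span ℤ (Set.range ![(⟨1, 0, 0, 0⟩ : ℍ[ℚ,-2,-5]), ⟨0, 1, 0, 0⟩, ⟨1/2, 1/2, 1/2, 0⟩, ⟨-1/2, 1/4, 0, 1/4⟩])) = (⟨⟨0, 0, 1, 0⟩, ⟨0, 0, -1/5, 0⟩, basisJ_mul_basisJInv, basisJInv_mul_basisJ⟩ : (ℍ[ℚ,-2,-5])ˣ) • (Submodule.span ℤ (Set.range ![(⟨1, 0, 0, 0⟩ : ℍ[ℚ,-2,-5]), ⟨0, 1, 0, 0⟩, ⟨1/2, 1/2, 1/2, 0⟩, ⟨-1/2, 1/4, 0, 1/4⟩])) := by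
  haveI := isQuaternionAlgebra
  obtain ⟨y, hy, huy⟩ := (exists_eq_basisJ_mul_iff hu).2 ⟨1, by rw [h5]; norm_num⟩
  have hy1 : reducedNorm ℚ ℍ[ℚ,-2,-5] y = 1 := by
    have h := h5
    rw [huy, reducedNorm_mul_holds ℚ ℍ[ℚ,-2,-5], reducedNorm_basisJ] at h
    linarith
  have hy0 : y ≠ 0 := by
    rintro rfl
    rw [mul_zero] at huy
    exact u.ne_zero huy
  set ε : (ℍ[ℚ,-2,-5])ˣ := (forall_isUnit y hy0).unit with hε
  have hεy : (ε : ℍ[ℚ,-2,-5]) = y := (forall_isUnit y hy0).unit_spec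
  have hεO : ε • (Submodule.span ℤ (Set.range ![(⟨1, 0, 0, 0⟩ : ℍ[ℚ,-2,-5]), ⟨0, 1, 0, 0⟩, ⟨1/2, 1/2, 1/2, 0⟩, ⟨-1/2, 1/4, 0, 1/4⟩])) = (Submodule.span ℤ (Set.range ![(⟨1, 0, 0, 0⟩ : ℍ[ℚ,-2,-5]), ⟨0, 1, 0, 0⟩, ⟨1/2, 1/2, 1/2, 0⟩, ⟨-1/2, 1/4, 0, 1/4⟩])) := (units_smul_lattice_eq_iff ε).2 ⟨by rw [hεy]; exact hy, by rw [hεy]; exact hy1⟩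
  have hu' : u = (⟨⟨0, 0, 1, 0⟩, ⟨0, 0, -1/5, 0⟩, basisJ_mul_basisJInv, basisJInv_mul_basisJ⟩ : (ℍ[ℚ,-2,-5])ˣ) * ε := by
    apply Units.ext
    rw [Units.val_mul, hεy]
    exact huy
  rw [hu', mul_smul, hεO]

/-- The same for `normPrimeIdeal`: every `u ∈ O₅` with `nrd u = 5` has `uO₅ = 𝔓`. [cite: VignerasLNM800, Ch. II §1 Lemme 1.5] -/
theorem units_smul_eq_normPrimeIdeal_of_reducedNorm_eq_five (u : (ℍ[ℚ,-2,-5])ˣ) (hu : (u : ℍ[ℚ,-2,-5]) ∈ (Submodule.span ℤ (Set.range ![(⟨1, 0, 0, 0⟩ : ℍ[ℚ,-2,-5]), ⟨0, 1, 0, 0⟩, ⟨1/2, 1/2, 1/2, 0⟩, ⟨-1/2, 1/4, 0, 1/4⟩])))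
    (h5 : reducedNorm ℚ ℍ[ℚ,-2,-5] (u : ℍ[ℚ,-2,-5]) = 5) : u • (Submodule.span ℤ (Set.range ![(⟨1, 0, 0, 0⟩ : ℍ[ℚ,-2,-5]), ⟨0, 1, 0, 0⟩, ⟨1/2, 1/2, 1/2, 0⟩, ⟨-1/2, 1/4, 0, 1/4⟩])) = normPrimeIdeal (Submodule.span ℤ (Set.range ![(⟨1, 0, 0, 0⟩ : ℍ[ℚ,-2,-5]), ⟨0, 1, 0, 0⟩, ⟨1/2, 1/2, 1/2, 0⟩, ⟨-1/2, 1/4, 0, 1/4⟩])) 5 := by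
  rw [normPrimeIdeal_five_eq, units_smul_eq_basisJUnit_smul_of_reducedNorm_eq_five u hu h5]

/-- `𝔓 ≠ O₅` (`1 ∉ jO₅`: `nrd 1 = 1` is not divisible by `5`). [cite: VignerasLNM800, Ch. II §1 Lemme 1.5] -/
theorem basisJUnit_smul_ne : (⟨⟨0, 0, 1, 0⟩, ⟨0, 0, -1/5, 0⟩, basisJ_mul_basisJInv, basisJInv_mul_basisJ⟩ : (ℍ[ℚ,-2,-5])ˣ) • (Submodule.span ℤ (Set.range ![(⟨1, 0, 0, 0⟩ : ℍ[ℚ,-2,-5]), ⟨0, 1, 0, 0⟩, ⟨1/2, 1/2, 1/2, 0⟩, ⟨-1/2, 1/4, 0, 1/4⟩])) ≠ (Submodule.span ℤ (Set.range ![(⟨1, 0, 0, 0⟩ : ℍ[ℚ,-2,-5]), ⟨0, 1, 0, 0⟩, ⟨1/2, 1/2, 1/2, 0⟩, ⟨-1/2, 1/4, 0, 1/4⟩])) := by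
  haveI := isQuaternionAlgebra
  intro h
  have h1 : (1 : ℍ[ℚ,-2,-5]) ∈ (⟨⟨0, 0, 1, 0⟩, ⟨0, 0, -1/5, 0⟩, basisJ_mul_basisJInv, basisJInv_mul_basisJ⟩ : (ℍ[ℚ,-2,-5])ˣ) • (Submodule.span ℤ (Set.range ![(⟨1, 0, 0, 0⟩ : ℍ[ℚ,-2,-5]), ⟨0, 1, 0, 0⟩, ⟨1/2, 1/2, 1/2, 0⟩, ⟨-1/2, 1/4, 0, 1/4⟩])) := by
    rw [h]
    exact one_mem_lattice
  rw [mem_basisJUnit_smul_iff] at h1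
  obtain ⟨n, hn⟩ := (exists_eq_basisJ_mul_iff one_mem_lattice).1 h1
  rw [reducedNorm_eq] at hn
  simp at hn
  have h5 : (5 : ℤ) ∣ 1 := ⟨n, by exact_mod_cast hn⟩
  omega

/-- `5O₅ ⊆ 𝔓`: `5y ∈ jO₅` for every `y ∈ O₅` (`5 = j·(−j)`). [cite: VignerasLNM800, Ch. II §1 Cor. 1.7] -/
theorem five_smul_mem_basisJUnit_smul {y : ℍ[ℚ,-2,-5]} (hy : y ∈ (Submodule.span ℤ (Set.range ![(⟨1, 0, 0, 0⟩ : ℍ[ℚ,-2,-5]), ⟨0, 1, 0, 0⟩, ⟨1/2, 1/2, 1/2, 0⟩, ⟨-1/2, 1/4, 0, 1/4⟩]))) : (5 : ℚ) • y ∈ (⟨⟨0, 0, 1, 0⟩, ⟨0, 0, -1/5, 0⟩, basisJ_mul_basisJInv, basisJInv_mul_basisJ⟩ : (ℍ[ℚ,-2,-5])ˣ) • (Submodule.span ℤ (Set.range ![(⟨1, 0, 0, 0⟩ : ℍ[ℚ,-2,-5]), ⟨0, 1, 0, 0⟩, ⟨1/2, 1/2, 1/2, 0⟩, ⟨-1/2,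 1/4, 0, 1/4⟩])) := by
  rw [mem_basisJUnit_smul_iff]
  refine ⟨-(⟨0, 0, 1, 0⟩ * y), ((Submodule.span ℤ (Set.range ![(⟨1, 0, 0, 0⟩ : ℍ[ℚ,-2,-5]), ⟨0, 1, 0, 0⟩, ⟨1/2, 1/2, 1/2, 0⟩, ⟨-1/2, 1/4, 0, 1/4⟩]))).neg_mem (mul_mem_lattice basisJ_mem_lattice hy), ?_⟩
  rw [mul_neg, ← mul_assoc, basisJ_mul_basisJ]
  ext <;> simp

end Ideal

end Literature.NumberTheory.Automorphic.MaxOrderDiscFive
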